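import Literature.Probability.Percolation.AdjProb
import Literature.Probability.Percolation.ArmSeparationExtFourAdj
import Literature.Probability.Percolation.ArmSeparationHalfStepFour
import HarnessLib

/-!
# Outward extension of the four adjacent landed arms on the sides `0, 1 | 3, 4`, at `p`

Topic `Literature/Probability/Percolation`; family `crit-perc` / near-critical percolation on `𝕋`.
A brick of the near-critical arm-separation theorem for four arms in the ADJACENT colour
arrangement (P. Nolin, EJP 13 (2008), Thm. 11, `j = 4`, `σ = BBWW` [arXiv 0711.4948: Thm. 10],
§4.3 Prop. 12 (i) via Lemma 13; §4.4 p. 12, the constant `C₀`): the landed event of the adjacent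
landing, `extFourAdjR n N` (two disjoint open arms landed on the CONSECUTIVE sides `0, 1`, read
through `ρ¹`, and two disjoint closed arms on the sides `3, 4`, read through `ρ³` of the
complement; `AdjProb.lean`, `AdjDuoLanding.lean`), extends outward at constant cost:

  `P_p(extFourAdjR n R) · (c^95)⁴ ≤ P_p(extFourAdjR n R')`  (`2200 ≤ R`, `2n ≤ R`, `2R ≤ R' ≤ 32R`).

This is the twin of `real_extFourAdjQ_mul_le_outward_at` (`ArmSeparationExtFourAdj.lean`, sides
`0, 2 | 3, 5`, read through the reflection frames) with the rotation `ρ¹` in place of the frame `2`: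
the cone of the side `1` is `{0 ≤ x₀, 0 < x₁}`, disjoint from the cone `{x₁ ≤ 0 < x₀ + x₁}` of the
side `0`; the bent corridors `sepOutCorrQ R R'` of the two sides are disjoint from each other and
from the other side's cone support, so the extended arms stay disjoint; Nolin's Lemma 13
(`triSitePercolation_locallyMonotone_fkg`) with the shell `{n ≤ |v| ≤ R}`, the increasing region
(cones `0, 1` beyond `Λ_R`) and the decreasing region (cones `3, 4`), Harris for the corridors.

* `extDuoConeSetR`, `mem_extOpenDuoR_iff`, `determinedBy_extOpenDuoR`, `measurableSet_extFourAdjR`;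
* `extOpenDuoR_inter_corr_subset`, `extFourAdjR_inter_corr_subset`;
* `real_extFourAdjR_mul_le_outward_at`.

Everything here is proved; no named facts are introduced.

## References

* P. Nolin, Near-critical percolation in two dimensions, *Electron. J. Probab.* 13 (2008), §4.3
  Prop. 12 (i), Lemma 13; §4.4 (arXiv 0711.4948: Prop. 11, Lemma 12; proof of Thm. 10), σ = BBWW [Nolin2008].
-/

noncomputable section

open MeasureTheory Set

namespace Literature.Probability.Percolation

open LatticeModels

/-! ### Locality -/

/-- **The cone support of the open pair on the sides `0, 1`**: the cone support of the side `0` and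
the `ρ¹`-image of it. [cite: Nolin2008, §4.2 Def. 6 (arXiv 0711.4948)] -/
def extDuoConeSetR (n N : ℕ) : Set (Site 2) := extConeSet n N ∪ {v | triRotIsoPow 5 v ∈ extConeSet n N}

/-- **Normalisation of the confining sets to the cone supports.** [folklore] -/
theorem mem_extOpenDuoR_iff {n N : ℕ} (hnN : 2 * n ≤ N) (ω : SiteConfig (Site 2)) :
    ω ∈ extOpenDuoR n N ↔ ∃ X Y : Set (Site 2), Disjoint X Y ∧ X ⊆ extConeSet n N ∧
      Y ⊆ {v | triRotIsoPow 5 v ∈ extConeSet n N} ∧ ω ∩ X ∈ extOpenArm n N ∧ rotConfig 1 (ω ∩ Y) ∈ extOpenArm n N := by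
  constructor
  · rintro ⟨X, Y, hXY, hX, hY⟩
    refine ⟨X ∩ extConeSet n N, Y ∩ {v | triRotIsoPow 5 v ∈ extConeSet n N},
      hXY.mono Set.inter_subset_left Set.inter_subset_left, Set.inter_subset_right, Set.inter_subset_right, ?_, ?_⟩
    · rw [← Set.inter_assoc]; exact (mem_extOpenArm_iff_inter_cone hnN _).1 hX
    · have h := (mem_extOpenArm_iff_inter_cone hnN _).1 hY
      rw [rotConfig_inter] at h ⊢
      convert h using 1
      ext v
      simp only [Set.mem_inter_iff, Set.mem_preimage, Set.mem_setOf_eq, rot5_rot1]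
      tauto
  · rintro ⟨X, Y, hXY, -, -, hX, hY⟩
    exact ⟨X, Y, hXY, hX, hY⟩

/-- **Locality of the open pair in the two cones** (`2n ≤ N`). [folklore] -/
theorem determinedBy_extOpenDuoR {n N : ℕ} (hnN : 2 * n ≤ N) : DeterminedBy (extOpenDuoR n N) (extDuoConeSetR n N) := by
  rw [determinedBy_iff]
  suffices key : ∀ ω ω' : SiteConfig (Site 2), ω ∩ extDuoConeSetR n N = ω' ∩ extDuoConeSetR n N →
      ω ∈ extOpenDuoR n N → ω' ∈ extOpenDuoR n N from
    fun ω ω' h => ⟨key ω ω' h, key ω' ω h.symm⟩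
  intro ω ω' h hω
  obtain ⟨X, Y, hXY, hXc, hYc, hX, hY⟩ := (mem_extOpenDuoR_iff hnN ω).1 hω
  have hXe : ω' ∩ X = ω ∩ X := by
    ext v
    constructor
    · rintro ⟨hv, hvX⟩
      have : v ∈ ω' ∩ extDuoConeSetR n N := ⟨hv, Or.inl (hXc hvX)⟩
      rw [← h] at this; exact ⟨this.1, hvX⟩
    · rintro ⟨hv, hvX⟩
      have : v ∈ ω ∩ extDuoConeSetR n N := ⟨hv, Or.inl (hXc hvX)⟩
      rw [h] at this; exact ⟨this.1, hvX⟩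
  have hYe : ω' ∩ Y = ω ∩ Y := by
    ext v
    constructor
    · rintro ⟨hv, hvY⟩
      have : v ∈ ω' ∩ extDuoConeSetR n N := ⟨hv, Or.inr (hYc hvY)⟩
      rw [← h] at this; exact ⟨this.1, hvY⟩
    · rintro ⟨hv, hvY⟩
      have : v ∈ ω ∩ extDuoConeSetR n N := ⟨hv, Or.inr (hYc hvY)⟩
      rw [h] at this; exact ⟨this.1, hvY⟩
  refine ⟨X, Y, hXY, ?_, ?_⟩
  · rw [hXe]; exact hX
  · rw [hYe]; exact hY

/-- The support of the open pair at scale `R`, inside the shell `{n ≤ |v| ≤ R}` and the cones of the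
sides `0, 1` beyond it (`R ≤ R'`). [folklore] -/
theorem extDuoConeSetR_subset {n R R' : ℕ} (hRR' : R ≤ R') :
    extDuoConeSetR n R ⊆ ↑((triBall R).filter fun v => (n : ℤ) ≤ triNorm v) ∪
      ↑((triBall (R' + R' / 8)).filter fun v : Site 2 =>
        (R : ℤ) < triNorm v ∧ ((v 1 ≤ 0 ∧ 0 < v 0 + v 1) ∨ (0 ≤ v 0 ∧ 0 < v 1))) := by
  have h88 : (R : ℤ) + (R / 8 : ℕ) ≤ (R' : ℤ) + (R' / 8 : ℕ) := by have := Nat.div_le_div_right (c := 8) hRR'; omega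
  rintro v (hv | hv)
  · rw [mem_extConeSet] at hv
    simp only [Set.mem_union, Finset.mem_coe, Finset.mem_filter, mem_triBall_iff]
    by_cases h : triNorm v ≤ (R : ℤ)
    · exact Or.inl ⟨h, hv.1⟩
    · right
      have hc := hv.2.2 (by omega)
      exact ⟨by push_cast; omega, by omega, Or.inl ⟨by omega, hc.2⟩⟩
  · simp only [Set.mem_setOf_eq, mem_extConeSet] at hv
    obtain ⟨f50, f51⟩ := rot5_apply v
    rw [triNorm_triRotIsoPow, f50, f51] at hv
    simp only [Set.mem_union, Finset.mem_coe, Finset.mem_filter, mem_triBall_iff]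
    by_cases h : triNorm v ≤ (R : ℤ)
    · exact Or.inl ⟨h, hv.1⟩
    · right
      have hc := hv.2.2 (by omega)
      exact ⟨by push_cast; omega, by omega, Or.inr ⟨by omega, by omega⟩⟩

/-- The open pair is measurable (`2n ≤ N`). [folklore] -/
theorem measurableSet_extOpenDuoR {n N : ℕ} (hnN : 2 * n ≤ N) : MeasurableSet (extOpenDuoR n N) := by
  have h := (determinedBy_extOpenDuoR hnN).mono (extDuoConeSetR_subset (n := n) (R := N) le_rfl)
  rw [← Finset.coe_union] at h
  exact h.measurableSet_of_finset

/-- The adjacent landed event is measurable (`2n ≤ N`). [folklore] -/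
theorem measurableSet_extFourAdjR {n N : ℕ} (hnN : 2 * n ≤ N) : MeasurableSet (extFourAdjR n N) := by
  have h1 := determinedBy_preimage_rotConfig 3
    ((determinedBy_extOpenDuoR hnN).mono (extDuoConeSetR_subset (n := n) (R := N) le_rfl))
  have h2 := DeterminedBy.preimage_compl' h1
  rw [← Finset.coe_union, ← Finset.coe_image] at h2
  exact (measurableSet_extOpenDuoR hnN).inter h2.measurableSet_of_finset

/-- The closed pair (read through `ρ³` of the complement) is decreasing. [folklore] -/
theorem isLowerSet_rot3_compl_extOpenDuoR (n N : ℕ) : IsLowerSet {ω : SiteConfig (Site 2) | rotConfig 3 ωᶜ ∈ extOpenDuoR n N} := by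
  intro ω ω' hle hω
  exact isUpperSet_extOpenDuoR n N (rotConfig_mono 3 (Set.compl_subset_compl.2 hle)) hω

/-! ### Deterministic outward extension of the pair -/

/-- **Outward extension of the two disjoint open arms along the bent corridors of the sides `0`
and `1`**: `extOpenDuoR n R ∩ (C ∩ {rotConfig 1 ω ∈ C}) ⊆ extOpenDuoR n R'`, `C = sepOutCorrQ R R'`
(`2200 ≤ R`, `2n ≤ R`, `2R ≤ R' ≤ 32R`). [cite: Nolin2008, §4.3 Prop. 12 (i) (proof) (arXiv 0711.4948: Prop. 11); §4.4 p. 12 (constant C₀), σ = BBWW] -/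
theorem extOpenDuoR_inter_corr_subset {n R R' : ℕ} (hR : 2200 ≤ R) (hnR : 2 * n ≤ R) (hRR' : 2 * R ≤ R')
    (hR'R : R' ≤ 32 * R) :
    extOpenDuoR n R ∩ (sepOutCorrQ R R' ∩ {ω | rotConfig 1 ω ∈ sepOutCorrQ R R'}) ⊆ extOpenDuoR n R' := by
  rintro ω ⟨hω, g0, g1⟩
  simp only [Set.mem_setOf_eq] at g1
  obtain ⟨X, Y, hXY, hXc, hYc, hX, hY⟩ := (mem_extOpenDuoR_iff hnR ω).1 hω
  have dC := determinedBy_sepOutCorrQ R R'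
  rw [determinedBy_iff] at dC
  -- the corridor sites and the new confining sets
  obtain ⟨F₀, hF₀⟩ : ∃ F₀ : Set (Site 2), F₀ = ↑(sepOutCorrQFinset R R') := ⟨_, rfl⟩
  have hF₀m : ∀ {v : Site 2}, v ∈ F₀ → v ∈ sepOutCorrQFinset R R' := fun hv => by rw [hF₀] at hv; exact Finset.mem_coe.1 hv
  refine ⟨X ∪ F₀, Y ∪ {v | triRotIsoPow 5 v ∈ F₀}, ?_, ?_, ?_⟩
  · -- disjointness
    rw [Set.disjoint_left]
    rintro v (hvX | hvF) (hvY | hvF')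
    · exact Set.disjoint_left.1 hXY hvX hvY
    · -- `v ∈ extConeSet`, `ρ⁵ v` a corridor site
      have h1 := mem_extConeSet.1 (hXc hvX)
      have hvF'' : triRotIsoPow 5 v ∈ F₀ := by simpa only [Set.mem_setOf_eq] using hvF'
      have h2 := sepOutCorrQFinset_subset hR hRR' hR'R (hF₀m hvF'')
      obtain ⟨f50, f51⟩ := rot5_apply v
      rw [triNorm_rot, f50, f51] at h2
      have h3 := h1.2.2 (by omega)
      omega
    · have h1 := sepOutCorrQFinset_subset hR hRR' hR'R (hF₀m hvF)
      have hvY' := hYc hvY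
      simp only [Set.mem_setOf_eq] at hvY'
      have h2 := mem_extConeSet.1 hvY'
      obtain ⟨f50, f51⟩ := rot5_apply v
      rw [triNorm_rot, f50, f51] at h2
      have h3 := h2.2.2 (by omega)
      omega
    · have h1 := sepOutCorrQFinset_subset hR hRR' hR'R (hF₀m hvF)
      have hvF'' : triRotIsoPow 5 v ∈ F₀ := by simpa only [Set.mem_setOf_eq] using hvF'
      have h2 := sepOutCorrQFinset_subset hR hRR' hR'R (hF₀m hvF'')
      obtain ⟨f50, f51⟩ := rot5_apply v
      rw [f50, f51] at h2
      omega
  · -- the arm of the side `0`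
    have hsub : ω ∩ X ⊆ ω ∩ (X ∪ F₀) := Set.inter_subset_inter_right _ Set.subset_union_left
    have hE : ω ∩ (X ∪ F₀) ∈ extOpenArm n R := isUpperSet_extOpenArm n R hsub hX
    have hC : ω ∩ (X ∪ F₀) ∈ sepOutCorrQ R R' := by
      refine (dC (ω ∩ (X ∪ F₀)) ω ?_).2 g0
      rw [← hF₀]
      ext v; simp only [Set.mem_inter_iff]
      exact ⟨fun h => ⟨h.1.1, h.2⟩, fun h => ⟨⟨h.1, Or.inr h.2⟩, h.2⟩⟩
    exact extOpenArm_inter_sepOutCorrQ_subset hR hnR hRR' hR'R ⟨hE, hC⟩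
  · -- the arm of the side `1`, read through `ρ¹`
    rw [rotConfig_inter] at hY ⊢
    have hpre : (triRotIsoPow 1) ⁻¹' (Y ∪ {v | triRotIsoPow 5 v ∈ F₀}) = (triRotIsoPow 1) ⁻¹' Y ∪ F₀ := by
      ext u
      simp only [Set.mem_preimage, Set.mem_union, Set.mem_setOf_eq, rot5_rot1]
    rw [hpre]
    set χ := rotConfig 1 ω with hχ
    have hsub : χ ∩ (triRotIsoPow 1) ⁻¹' Y ⊆ χ ∩ ((triRotIsoPow 1) ⁻¹' Y ∪ F₀) :=
      Set.inter_subset_inter_right _ Set.subset_union_left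
    have hE : χ ∩ ((triRotIsoPow 1) ⁻¹' Y ∪ F₀) ∈ extOpenArm n R := isUpperSet_extOpenArm n R hsub hY
    have hC : χ ∩ ((triRotIsoPow 1) ⁻¹' Y ∪ F₀) ∈ sepOutCorrQ R R' := by
      refine (dC _ χ ?_).2 g1
      rw [← hF₀]
      ext v; simp only [Set.mem_inter_iff]
      exact ⟨fun h => ⟨h.1.1, h.2⟩, fun h => ⟨⟨h.1, Or.inr h.2⟩, h.2⟩⟩
    exact extOpenArm_inter_sepOutCorrQ_subset hR hnR hRR' hR'R ⟨hE, hC⟩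

/-- **Outward extension of the four adjacent landed arms** along the four corridors
(`ρ¹ ∘ ρ³ = ρ⁴` for the second closed arm). [cite: Nolin2008, §4.3 Prop. 12 (i) (proof) (arXiv 0711.4948: Prop. 11), σ = BBWW] -/
theorem extFourAdjR_inter_corr_subset {n R R' : ℕ} (hR : 2200 ≤ R) (hnR : 2 * n ≤ R) (hRR' : 2 * R ≤ R')
    (hR'R : R' ≤ 32 * R) :
    extFourAdjR n R ∩ ((sepOutCorrQ R R' ∩ {ω | rotConfig 1 ω ∈ sepOutCorrQ R R'}) ∩
      ({ω | rotConfig 3 ωᶜ ∈ sepOutCorrQ R R'} ∩ {ω | rotConfig 4 ωᶜ ∈ sepOutCorrQ R R'})) ⊆ extFourAdjR n R' := by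
  rintro ω ⟨⟨hO, hCl⟩, gO, ⟨g3, g4⟩⟩
  refine ⟨extOpenDuoR_inter_corr_subset hR hnR hRR' hR'R ⟨hO, gO⟩, extOpenDuoR_inter_corr_subset hR hnR hRR' hR'R ⟨hCl, g3, ?_⟩⟩
  simp only [Set.mem_setOf_eq] at g4 ⊢
  rw [rotConfig_rotConfig]; exact g4

/-! ### The extension inequality at `p` -/

/-- **Outward extension of the four adjacent landed arms (sides `0, 1 | 3, 4`) at constant cost, at
`p`**: `P_p(extFourAdjR n R) · (c^95)⁴ ≤ P_p(extFourAdjR n R')` (`2200 ≤ R`, `2n ≤ R`,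
`2R ≤ R' ≤ 32R`, `R' ≤ Ncap`; RSW input at `p` and `1 - p`, aspect ratio `ρ ≥ 64`). Nolin's Lemma
13 with the shell `{n ≤ |v| ≤ R}`, the increasing region `{R < |v|} ∩ (cone 0 ∪ cone 1)` and the
decreasing region `{R < |v|} ∩ (cone 3 ∪ cone 4)`, Harris at `p` for the two open corridors and at
`1 - p` for the two closed ones, and the deterministic extension. [cite: Nolin2008, §4.3 Prop. 12 (i) and Lemma 13 (arXiv 0711.4948: Prop. 11, Lemma 12); §4.4 p. 12, σ = BBWW] -/
theorem real_extFourAdjR_mul_le_outward_at (p : unitInterval) {c : ℝ} {ρ Ncap : ℕ}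
    (hrsw : ∀ q : unitInterval, (q = p ∨ q = unitInterval.symm p) →
      ∀ k : ℕ, 1 ≤ ⌊(ρ : ℝ) * k⌋₊ → k ≤ Ncap → c ≤ triLRCrossingProb q ⌊(ρ : ℝ) * k⌋₊ k)
    (hρ : 64 ≤ ρ) (hc : 0 ≤ c) {n R R' : ℕ} (hR : 2200 ≤ R) (hnR : 2 * n ≤ R) (hRR' : 2 * R ≤ R') (hR'R : R' ≤ 32 * R)
    (hcap : R' ≤ Ncap) :
    (triSitePercolation p).real (extFourAdjR n R) * (c ^ 95) ^ 4 ≤ (triSitePercolation p).real (extFourAdjR n R') := by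
  classical
  set C := sepOutCorrQ R R' with hC
  -- the three pairwise disjoint regions of Nolin's Lemma 13
  set S : Finset (Site 2) := (triBall R).filter (fun v => (n : ℤ) ≤ triNorm v) with hS
  set P : Finset (Site 2) := (triBall (R' + R' / 8)).filter
    (fun v => (R : ℤ) < triNorm v ∧ ((v 1 ≤ 0 ∧ 0 < v 0 + v 1) ∨ (0 ≤ v 0 ∧ 0 < v 1))) with hP
  set M : Finset (Site 2) := (triBall (R' + R' / 8)).filter
    (fun v => (R : ℤ) < triNorm v ∧ ((0 ≤ v 1 ∧ v 0 + v 1 < 0) ∨ (v 0 ≤ 0 ∧ v 1 < 0))) with hM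
  have hSP : Disjoint S P := by
    rw [Finset.disjoint_left]; intro v hvS hvP
    simp only [hS, hP, Finset.mem_filter, mem_triBall_iff] at hvS hvP
    omega
  have hSM : Disjoint S M := by
    rw [Finset.disjoint_left]; intro v hvS hvM
    simp only [hS, hM, Finset.mem_filter, mem_triBall_iff] at hvS hvM
    omega
  have hPM : Disjoint P M := by
    rw [Finset.disjoint_left]; intro v hvP hvM
    simp only [hP, hM, Finset.mem_filter] at hvP hvM
    omega
  have hRR : 2 * (R : ℤ) ≤ R' := by exact_mod_cast hRR'
  -- supports of the corridors: rotations `0, 1` in `P`, rotations `3, 4` in `M`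
  have corr0 : (↑(sepOutCorrQFinset R R') : Set (Site 2)) ⊆ ↑P := fun v hv => by
    have h := sepOutCorrQFinset_subset hR hRR' hR'R (Finset.mem_coe.1 hv)
    simp only [hP, Finset.mem_coe, Finset.mem_filter, mem_triBall_iff]
    push_cast; exact ⟨h.2.1, h.1, Or.inl ⟨h.2.2.1, h.2.2.2⟩⟩
  have corr1 : triRotIsoPow 1 '' (↑(sepOutCorrQFinset R R') : Set (Site 2)) ⊆ ↑P := by
    rintro v ⟨u, hu, rfl⟩
    have h := sepOutCorrQFinset_subset hR hRR' hR'R (Finset.mem_coe.1 hu)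
    obtain ⟨f10, f11⟩ := rot1_apply u
    simp only [hP, Finset.mem_coe, Finset.mem_filter, mem_triBall_iff, triNorm_triRotIsoPow]
    push_cast; refine ⟨h.2.1, h.1, Or.inr ?_⟩; rw [f10, f11]; omega
  have corr3 : triRotIsoPow 3 '' (↑(sepOutCorrQFinset R R') : Set (Site 2)) ⊆ ↑M := by
    rintro v ⟨u, hu, rfl⟩
    have h := sepOutCorrQFinset_subset hR hRR' hR'R (Finset.mem_coe.1 hu)
    obtain ⟨-, -, -, -, -, -, f30, f31, -⟩ := rot_apply_formula u
    simp only [hM, Finset.mem_coe, Finset.mem_filter, mem_triBall_iff, triNorm_triRotIsoPow]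
    push_cast; refine ⟨h.2.1, h.1, Or.inl ?_⟩; rw [f30, f31]; omega
  have corr4 : triRotIsoPow 4 '' (↑(sepOutCorrQFinset R R') : Set (Site 2)) ⊆ ↑M := by
    rintro v ⟨u, hu, rfl⟩
    have h := sepOutCorrQFinset_subset hR hRR' hR'R (Finset.mem_coe.1 hu)
    obtain ⟨-, -, -, -, -, -, -, -, f40, f41, -⟩ := rot_apply_formula u
    simp only [hM, Finset.mem_coe, Finset.mem_filter, mem_triBall_iff, triNorm_triRotIsoPow]
    push_cast; refine ⟨h.2.1, h.1, Or.inr ?_⟩; rw [f40, f41]; omega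
  -- supports of the pairs
  have dOpen : DeterminedBy (extOpenDuoR n R) (↑S ∪ ↑P) :=
    (determinedBy_extOpenDuoR hnR).mono (extDuoConeSetR_subset (n := n) (R := R) (R' := R') (by omega))
  have hSM3 : triRotIsoPow 3 '' (↑S ∪ ↑P : Set (Site 2)) ⊆ ↑S ∪ ↑M := by
    rintro v ⟨u, hu, rfl⟩
    obtain ⟨-, -, -, -, -, -, f30, f31, -⟩ := rot_apply_formula u
    simp only [hS, hP, hM, Set.mem_union, Finset.mem_coe, Finset.mem_filter, mem_triBall_iff, triNorm_triRotIsoPow] at hu ⊢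
    rw [f30, f31]
    rcases hu with hu | hu
    · exact Or.inl hu
    · right; refine ⟨hu.1, hu.2.1, ?_⟩; omega
  have dClosed : DeterminedBy {ω : SiteConfig (Site 2) | rotConfig 3 ωᶜ ∈ extOpenDuoR n R} (↑S ∪ ↑M) :=
    (DeterminedBy.preimage_compl' (determinedBy_preimage_rotConfig 3 dOpen)).mono hSM3
  -- the events
  set Ap : Set (SiteConfig (Site 2)) := extOpenDuoR n R with hAp
  set Am : Set (SiteConfig (Site 2)) := {ω : SiteConfig (Site 2) | rotConfig 3 ωᶜ ∈ extOpenDuoR n R} with hAm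
  set Bp : Set (SiteConfig (Site 2)) := C ∩ {ω | rotConfig 1 ω ∈ C} with hBp
  set Bm : Set (SiteConfig (Site 2)) := {ω | rotConfig 3 ωᶜ ∈ C} ∩ {ω | rotConfig 4 ωᶜ ∈ C} with hBm
  have huC := isUpperSet_sepOutCorrQ R R'
  have upre : ∀ {F : Set (SiteConfig (Site 2))}, IsUpperSet F → ∀ i, IsUpperSet {ω : SiteConfig (Site 2) | rotConfig i ω ∈ F} :=
    fun hF i ω ω' h hω => hF (rotConfig_mono i h) hω
  have lpre : ∀ {F : Set (SiteConfig (Site 2))}, IsUpperSet F → ∀ i, IsLowerSet {ω : SiteConfig (Site 2) | rotConfig i ωᶜ ∈ F} :=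
    fun hF i ω ω' h hω => hF (rotConfig_mono i (Set.compl_subset_compl.2 h)) hω
  have hAp_up : IsUpperSet Ap := isUpperSet_extOpenDuoR n R
  have hAm_lo : IsLowerSet Am := isLowerSet_rot3_compl_extOpenDuoR n R
  have hBp_up : IsUpperSet Bp := huC.inter (upre huC 1)
  have hBm_lo : IsLowerSet Bm := (lpre huC 3).inter (lpre huC 4)
  -- locality of the corridors
  have dC := determinedBy_sepOutCorrQ R R'
  have dCr : ∀ i, DeterminedBy {ω : SiteConfig (Site 2) | rotConfig i ω ∈ C} (triRotIsoPow i '' ↑(sepOutCorrQFinset R R')) :=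
    fun i => determinedBy_preimage_rotConfig i dC
  have dCrc : ∀ i, DeterminedBy {ω : SiteConfig (Site 2) | rotConfig i ωᶜ ∈ C} (triRotIsoPow i '' ↑(sepOutCorrQFinset R R')) := fun i => by
    have hset : {ω : SiteConfig (Site 2) | rotConfig i ωᶜ ∈ C} = rotConfig i ⁻¹' {χ : Set (Site 2) | χᶜ ∈ C} := by
      ext ω; simp only [Set.mem_setOf_eq, Set.mem_preimage, rotConfig_compl]
    rw [hset]
    exact determinedBy_preimage_rotConfig i (determinedBy_compl_mem dC)
  have dBp : DeterminedBy Bp ↑P := (dC.mono corr0).inter ((dCr 1).mono corr1)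
  have dBm : DeterminedBy Bm ↑M := ((dCrc 3).mono corr3).inter ((dCrc 4).mono corr4)
  have fkg := triSitePercolation_locallyMonotone_fkg p hSP hSM hPM hAp_up hAm_lo hBp_up hBm_lo dOpen dClosed dBp dBm
  -- the corridor probabilities
  have hcorr : ∀ q : unitInterval, (q = p ∨ q = unitInterval.symm p) → c ^ 95 ≤ (triSitePercolation q).real C :=
    fun q hq => le_real_sepOutCorrQ_at q (hrsw q hq) hρ hc hR hRR' hR'R hcap
  set F := sepOutCorrQFinset R R' with hF
  have hBp_ge : (c ^ 95) ^ 2 ≤ (triSitePercolation p).real Bp := by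
    have h2 : (triSitePercolation p).real {ω : SiteConfig (Site 2) | rotConfig 1 ω ∈ C} = (triSitePercolation p).real C :=
      real_preimage_rotConfig p 1 C
    have dC' : DeterminedBy C ↑F := dC
    have d2' : DeterminedBy {ω : SiteConfig (Site 2) | rotConfig 1 ω ∈ C} ↑(F.image (triRotIsoPow 1)) := by
      rw [Finset.coe_image]; exact dCr 1
    have har := sitePercolation_harris' p dC' d2' huC (upre huC 1)
    unfold triSitePercolation at h2 hcorr ⊢
    rw [h2] at har
    have h1 := hcorr p (Or.inl rfl)
    calc (c ^ 95) ^ 2 = c ^ 95 * c ^ 95 := sq _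
      _ ≤ (sitePercolation (Site 2) p).real C * (sitePercolation (Site 2) p).real C :=
          mul_le_mul h1 h1 (pow_nonneg hc _) measureReal_nonneg
      _ ≤ _ := har
  have hBm_ge : (c ^ 95) ^ 2 ≤ (triSitePercolation p).real Bm := by
    set q := unitInterval.symm p with hq
    have heq : Bm = compl ⁻¹' ({χ : SiteConfig (Site 2) | rotConfig 3 χ ∈ C} ∩ {χ | rotConfig 4 χ ∈ C}) := by
      ext ω; simp only [hBm, Set.mem_inter_iff, Set.mem_setOf_eq, Set.mem_preimage]
    have hcmp := sitePercolation_real_preimage_compl p ({χ : SiteConfig (Site 2) | rotConfig 3 χ ∈ C} ∩ {χ | rotConfig 4 χ ∈ C})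
    have h3 : (triSitePercolation q).real {ω : SiteConfig (Site 2) | rotConfig 3 ω ∈ C} = (triSitePercolation q).real C :=
      real_preimage_rotConfig q 3 C
    have h5 : (triSitePercolation q).real {ω : SiteConfig (Site 2) | rotConfig 4 ω ∈ C} = (triSitePercolation q).real C :=
      real_preimage_rotConfig q 4 C
    have d3' : DeterminedBy {ω : SiteConfig (Site 2) | rotConfig 3 ω ∈ C} ↑(F.image (triRotIsoPow 3)) := by
      rw [Finset.coe_image]; exact dCr 3
    have d5' : DeterminedBy {ω : SiteConfig (Site 2) | rotConfig 4 ω ∈ C} ↑(F.image (triRotIsoPow 4)) := by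
      rw [Finset.coe_image]; exact dCr 4
    have har := sitePercolation_harris' q d3' d5' (upre huC 3) (upre huC 4)
    unfold triSitePercolation at h3 h5 hcorr hcmp ⊢
    rw [h3, h5] at har
    rw [heq, hcmp]
    have h1 := hcorr q (Or.inr rfl)
    calc (c ^ 95) ^ 2 = c ^ 95 * c ^ 95 := sq _
      _ ≤ (sitePercolation (Site 2) q).real C * (sitePercolation (Site 2) q).real C :=
          mul_le_mul h1 h1 (pow_nonneg hc _) measureReal_nonneg
      _ ≤ _ := har
  -- assemble
  have hAA : extFourAdjR n R = Ap ∩ Am := by ext ω; rfl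
  have hsub := extFourAdjR_inter_corr_subset (n := n) hR hnR hRR' hR'R
  have h0 : 0 ≤ (triSitePercolation p).real (extFourAdjR n R) := measureReal_nonneg
  calc (triSitePercolation p).real (extFourAdjR n R) * (c ^ 95) ^ 4
      = (triSitePercolation p).real (extFourAdjR n R) * ((c ^ 95) ^ 2 * (c ^ 95) ^ 2) := by ring
    _ ≤ (triSitePercolation p).real (Ap ∩ Am) * ((triSitePercolation p).real Bp * (triSitePercolation p).real Bm) := by
        rw [hAA]
        exact mul_le_mul_of_nonneg_left (mul_le_mul hBp_ge hBm_ge (by positivity) measureReal_nonneg) (by rw [← hAA]; exact h0)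
    _ ≤ (triSitePercolation p).real (Ap ∩ Am ∩ (Bp ∩ Bm)) := fkg
    _ ≤ (triSitePercolation p).real (extFourAdjR n R') := by
        refine measureReal_mono ?_ (measure_ne_top _ _)
        intro ω hω
        exact hsub ⟨by rw [hAA]; exact hω.1, hω.2.1, hω.2.2⟩

end Literature.Probability.Percolation
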